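import Summits.QuantumFields.BalabanUV.T4Continuum.Support.NE7HierarchicalStep
import Summits.QuantumFields.BalabanUV.T4Continuum.Support.NE7CurvedExactLiftComposites
import HarnessLib

/-!
# NE7HierarchicalRepresentative — THE HIERARCHICAL REPRESENTATIVE OF A FIBRE ELEMENT ALONG A TOWER (route (H′), step (K) iterated): for the original linearised tower `X_{i+1} = cpush 2 W_i X_i`
# there are potentials `ν_i` (skew, `Q_i`-periodic, `ν_T = 0`, **`ν_i (2•y) = ν_{i+1} y`**) and one-level slice elements `J_i ∈ frameFreeBlockLandauW 2 Q_{i+1} 1 W_i` with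
# **`X_i + gaugeDir W_i ν_i = (r + δ)_i (X_{i+1} + gaugeDir W_{i+1} ν_{i+1}) + J_i`** for every `i < T` — the representative `X′_i := X_i + gaugeDir W_i ν_i` obeys the recursion of the
# root-form budget with the EXACT CURVED LIFTS ✓ `rTower + dTower` (composites ✓ (C_W)) and is, level by level, the original tower shifted by a gauge direction whose potential samples down
# to `ν_T = 0` (so `ν_0` vanishes on the top corners `2^T ℤ⁴`)
# (lineage `b2b-balaban-t4-ne7b-p1`, gen 163; route (H′), memo `t4/b2b-balaban-t4-ne7b-p1/g162/records/SCOPING-LEVELMASSES.md` §8 + (K))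

Cell `pub-balaban`, rung (B)+1 sub-cell t4, lineage `b2b-balaban-t4-ne7b-p1` (row NE7b OWNER + CRUX PROVER; junction service for row NE7 on ROAD-G116 §6 (G3) ∕ the ℓ² route to (G′)),
generation 163.  ✓ `NE7HierarchicalStep.hierarchical_step` iterated downward from the top; the tower data are ✓ `NE7CurvedExactLiftComposites.TowerHyps` plus `W_{i+1} = cavg 2 W_i`.
WHAT ([folklore]; DATA def `RepOn` (the bookkeeping predicate, tagged); 0 sorry; `d = 4`, `L = 2`): `nu_top_corner` (sampling consistency ⇒ `ν_0 (2^T • z) = ν_T z`), and the headline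
**`hierarchical_representative`**.
WHAT IS NOT HERE: the level-mass budget on the representative ((G3) assembly: ✓ `curved_composite_le` + ✓ `curlSq_curvedLift_le` + slice Poincaré + road G5 + ✓ p834121) — successor.
HONEST FRAMING (page 1): composition of kernel theorems about OUR objects; nothing of Bałaban's asserted; NOT (G3), NOT (G′), NOT NE7∕NE3 as spine nodes; row NE7b NOT PRINTED ∕ NOT PROVED;
spine 0∕9; finite T⁴ rung (B)+1 — NOT infinite volume, NOT mass gap, NOT BetaPertH, NOT Clay.
-/

set_option autoImplicit false

open scoped BigOperators Matrix Matrix.Norms.L2Operator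
open Finset

namespace Summit.QuantumFields.BalabanUV.T4Continuum.NE7HierarchicalRepresentative

open Literature.MathematicalPhysics.QuantumFieldTheory.Balaban1983to89
open B7Prop1Explicit
open T4AveragingDeficitWall (IsUnitaryCfg IsSkewDir SmallField)
open T4AveragingDeficitWallBoundary (IsPeriodicCfg)
open AveragingDeficitPeriodicCounting (IsPeriodicDir)
open AveragingDeficitMultiLevelPrep (cpush tower LevelSmall)
open AveragingDeficitChartCalculus (cavg)
open BlockAveragePushDirGauge (gaugeDir)
open NE3TangentCovariantTower (step_small)
open NE3LandauOrbit (gaugeDir_skew)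
open NE3FrameFreeSliceW (frameFreeBlockLandauW)
open NE7HierarchicalStep (hierarchical_step)
open NE7CurvedExactLiftComposites (Qper Qper_succ TowerHyps rTower dTower rTower_add_dTower_apply)

noncomputable section

variable {n : Type*} [Fintype n] [DecidableEq n] [Nonempty n]
variable {P T : ℕ} [NeZero P] {W : ℕ → Site 4 → Fin 4 → (Matrix n n ℂ)ˣ} {x b : ℕ → ℝ}

/-- **THE BOOKKEEPING PREDICATE**: potentials `ν` and slice elements `J` represent the tower `X` on the index window `[s, T]` — a definition, asserted of nothing. [folklore] -/
@[folklore]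
def RepOn (H : TowerHyps n P T W x b) (X : ℕ → Site 4 → Fin 4 → Matrix n n ℂ) (s : ℕ) (ν : ℕ → Site 4 → Matrix n n ℂ) (J : ℕ → Site 4 → Fin 4 → Matrix n n ℂ) : Prop :=
  ν T = 0 ∧
  (∀ i, s ≤ i → i ≤ T → (∀ y, ν i y ∈ skewAdjoint (Matrix n n ℂ)) ∧ (∀ (y : Site 4) (j : Fin 4), ν i (y + (Qper P T i : ℤ) • e j) = ν i y)) ∧
  (∀ i, s ≤ i → i < T → ∀ y : Site 4, ν i ((2 : ℤ) • y) = ν (i + 1) y) ∧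
  (∀ i, s ≤ i → i < T → J i ∈ frameFreeBlockLandauW (d := 4) (n := n) 2 (Qper P T (i + 1)) 1 (W i) ∧ cpush 2 (W i) (J i) = 0 ∧
      (X i + gaugeDir (W i) (ν i)) = (rTower (n := n) P T + dTower H) i (X (i + 1) + gaugeDir (W (i + 1)) (ν (i + 1))) + J i)

/-- **THE HIERARCHICAL REPRESENTATIVE EXISTS** (`d = 4`, `L = 2`): for tower data `H : TowerHyps`, consecutive backgrounds `W (i+1) = cavg 2 (W i)`, a unitary top background `W T`, and an
original tower `X (i+1) = cpush 2 (W i) (X i)` of skew `Q_i`-periodic fields, there are `ν`, `J` with `RepOn H X 0 ν J`. [folklore] -/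
theorem hierarchical_representative (H : TowerHyps n P T W x b) (hcavg : ∀ i, i < T → W (i + 1) = cavg 2 (W i)) (hWT : IsUnitaryCfg (W T))
    {X : ℕ → Site 4 → Fin 4 → Matrix n n ℂ} (hXs : ∀ i, i ≤ T → IsSkewDir (X i)) (hXP : ∀ i, i ≤ T → IsPeriodicDir (X i) (Qper P T i : ℤ))
    (hX : ∀ i, i < T → X (i + 1) = cpush 2 (W i) (X i)) :
    ∃ (ν : ℕ → Site 4 → Matrix n n ℂ) (J : ℕ → Site 4 → Fin 4 → Matrix n n ℂ), RepOn H X 0 ν J := by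
  -- unitarity of every background (class lines for `i < T`, hypothesis at `T`)
  have hWu : ∀ i, i ≤ T → IsUnitaryCfg (W i) := fun i hi => by
    rcases Nat.lt_or_ge i T with h | h
    · exact H.hWu i h
    · rw [show i = T by omega]; exact hWT
  -- downward induction on the window `[T - k, T]`
  suffices hwin : ∀ k, k ≤ T → ∃ (ν : ℕ → Site 4 → Matrix n n ℂ) (J : ℕ → Site 4 → Fin 4 → Matrix n n ℂ), RepOn H X (T - k) ν J by
    obtain ⟨ν, J, h⟩ := hwin T le_rfl
    exact ⟨ν, J, by rwa [Nat.sub_self] at h⟩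
  intro k
  induction k with
  | zero =>
      intro _
      refine ⟨fun _ _ => 0, fun _ _ _ => 0, rfl, fun i _ _ => ⟨fun y => (skewAdjoint _).zero_mem, fun y j => rfl⟩, fun i hi hiT => by omega, fun i hi hiT => by omega⟩
  | succ k ih =>
      intro hk
      obtain ⟨ν, J, htop, hinv, hsamp, hrec⟩ := ih (by omega)
      set i₀ : ℕ := T - (k + 1) with hi₀
      have hi₀T : i₀ < T := by omega
      have hi₀1 : i₀ + 1 = T - k := by omega
      -- the data at `i₀ + 1`
      obtain ⟨hνs, hνP⟩ := hinv (i₀ + 1) (by omega) (by omega)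
      -- the step at `i₀`
      have hWP := H.hWP i₀ hi₀T
      have hXP₀ : IsPeriodicDir (X i₀) ((tower 2 (Qper P T (i₀ + 1)) (0 + 1) : ℕ) : ℤ) := by
        have h := hXP i₀ hi₀T.le
        rw [show (((tower 2 (Qper P T (i₀ + 1)) (0 + 1) : ℕ) : ℤ)) = (Qper P T i₀ : ℤ) by simp [tower, Qper_succ hi₀T]]
        exact h
      have hX's : IsSkewDir (fun y μ => cpush 2 (W i₀) (X i₀) y μ + gaugeDir (cavg 2 (W i₀)) (ν (i₀ + 1)) y μ) := by
        rw [← hcavg i₀ hi₀T, ← hX i₀ hi₀T]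
        exact fun y μ => (skewAdjoint _).add_mem (hXs (i₀ + 1) (by omega) y μ) (gaugeDir_skew (hWu (i₀ + 1) (by omega)) hνs y μ)
      obtain ⟨ν₀, hν₀s, hν₀P, hν₀samp, J₀, hJ₀, hJ₀0, hid⟩ :=
        hierarchical_step (H.hWu i₀ hi₀T) (H.hx i₀ hi₀T) (H.hs i₀ hi₀T) (H.hWx i₀ hi₀T) (Qper P T (i₀ + 1)) (H.hθ i₀ hi₀T) (H.hE i₀ hi₀T) hWP
          (hXs i₀ hi₀T.le) hXP₀ hνs hνP hX's
      -- extend the sequences at `i₀`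
      refine ⟨fun i => if i = i₀ then ν₀ else ν i, fun i => if i = i₀ then J₀ else J i, ?_, ?_, ?_, ?_⟩
      · simp only [show T ≠ i₀ by omega, if_false]; exact htop
      · intro i hi hiT
        by_cases h : i = i₀
        · subst h
          simp only [if_true]
          refine ⟨hν₀s, fun y j => ?_⟩
          have h2 := hν₀P y j
          rw [show (((tower 2 (Qper P T (i₀ + 1)) (0 + 1) : ℕ) : ℤ)) = (Qper P T i₀ : ℤ) by simp [tower, Qper_succ hi₀T]] at h2
          exact h2
        · simp only [h, if_false]; exact hinv i (by omega) hiT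
      · intro i hi hiT y
        by_cases h : i = i₀
        · subst h
          simp only [if_true, show i₀ + 1 ≠ i₀ by omega, if_false]
          exact hν₀samp y
        · simp only [h, if_false, show i + 1 ≠ i₀ by omega]
          exact hsamp i (by omega) hiT y
      · intro i hi hiT
        by_cases h : i = i₀
        · subst h
          simp only [if_true, show i₀ + 1 ≠ i₀ by omega, if_false]
          refine ⟨hJ₀, hJ₀0, ?_⟩
          rw [rTower_add_dTower_apply H hi₀T (show IsSkewDir (X (i₀ + 1) + gaugeDir (W (i₀ + 1)) (ν (i₀ + 1))) from by
            have h' := hX's; rw [← hcavg i₀ hi₀T, ← hX i₀ hi₀T] at h'; exact h')]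
          have hw : (X (i₀ + 1) + gaugeDir (W (i₀ + 1)) (ν (i₀ + 1))) = fun y μ => cpush 2 (W i₀) (X i₀) y μ + gaugeDir (cavg 2 (W i₀)) (ν (i₀ + 1)) y μ := by
            rw [← hcavg i₀ hi₀T, ← hX i₀ hi₀T]; rfl
          have hlhs : (X i₀ + gaugeDir (W i₀) ν₀) = fun y μ => X i₀ y μ + gaugeDir (W i₀) ν₀ y μ := rfl
          rw [hlhs, hid]
          funext y μ
          simp only [Pi.add_apply]
          congr 2
          exact hw.symm
        · simp only [h, if_false, show i + 1 ≠ i₀ by omega]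
          exact hrec i (by omega) hiT

/-- **SAMPLING CONSISTENCY DOWN THE TOWER**: `ν_i (2^{t} • y) = ν_{i+t} y` on the window; in particular `ν_0 (2^T • z) = ν_T z = 0` — the bottom potential vanishes on the top corners. [folklore] -/
theorem nu_sample_iter (H : TowerHyps n P T W x b) {X : ℕ → Site 4 → Fin 4 → Matrix n n ℂ} {ν : ℕ → Site 4 → Matrix n n ℂ} {J : ℕ → Site 4 → Fin 4 → Matrix n n ℂ}
    (h : RepOn H X 0 ν J) : ∀ (t i : ℕ), i + t ≤ T → ∀ y : Site 4, ν i (((2 : ℤ) ^ t) • y) = ν (i + t) y := by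
  obtain ⟨-, -, hsamp, -⟩ := h
  intro t
  induction t with
  | zero => intro i _ y; simp
  | succ t ih =>
      intro i hit y
      rw [pow_succ, mul_comm, ← smul_smul, hsamp i (Nat.zero_le _) (by omega) (((2 : ℤ) ^ t) • y), ih (i + 1) (by omega) y, show i + 1 + t = i + (t + 1) by ring]

/-- **THE BOTTOM POTENTIAL VANISHES ON THE TOP CORNERS**: `ν_0 (2^T • z) = 0`. [folklore] -/
theorem nu_top_corner (H : TowerHyps n P T W x b) {X : ℕ → Site 4 → Fin 4 → Matrix n n ℂ} {ν : ℕ → Site 4 → Matrix n n ℂ} {J : ℕ → Site 4 → Fin 4 → Matrix n n ℂ}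
    (h : RepOn H X 0 ν J) (z : Site 4) : ν 0 (((2 : ℤ) ^ T) • z) = 0 := by
  have h1 := nu_sample_iter H h T 0 (by omega) z
  rw [zero_add, h.1] at h1
  exact h1

end

end Summit.QuantumFields.BalabanUV.T4Continuum.NE7HierarchicalRepresentative
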